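import Summits.QuantumFields.YangMills.Theorems.AlphaInputsT3ACv3StepLowWeightedT3
import Summits.QuantumFields.YangMills.Theorems.AlphaInputsT3ACChargeOnInteriorWindow
import Summits.QuantumFields.YangMills.Theorems.AlphaInputsT3ACv3StepLowPrintOrbitOfUniqueMin
import HarnessLib

/-!
# `AlphaInputsT3ACv3StepLowWeightedPrint` — THE RC-B LOWER ROW AT PRINT'S FAMILY, FULLY ASSEMBLED: small-field weight `χB_k(triv′)·𝟙[loPrintAC k]` (print's χ_k of (47)) in the (58) floor, NO
# `hdom`, the charging letter from the interior window (door 3), the family's gauge invariance from [7] Thm 1's uniqueness clause (door 1) — displayed: charts, Gaussian datum, `hinv`, the WEIGHTED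
# pins, `hγs`, `ha₁`, `hfloor`, `huniq` (cell `ym3-torus`, (α)-row #23, post-freeze (R7a∕R7d) docket input; seat `ym3-torus-px20` g14 — DOOR 4 part 3; `--supports stmt-QuantumFields-19936 --as helper`)

WHAT.  ★★★★ `AlphaInputsT3AC.PkgCoreRows.fibre57LowOnAC_T3_loPrintAC_chiMin_weight_of_floor` = the weight socket ✓`PinnedStepTrivPins.fibre57LowOnAC_T3_of_le_gamma_of_hcharge_weight`
(✓`…WeightedT3` §4) at the rows record `q` with `lo := loPrintAC 𝔠.lane q.X` and `wt := χB_k(triv′)·𝟙[loPrintAC k]` (✓`chiB_mul_indicator_props`: `hwtlo` DEFINITIONAL), `hav`∕data rows∕`hlom`∕`hlom₁`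
by name (as ✓`fibre57LowOnAC_T3_loPrintAC_of_le_gamma`), `hloinv` = ✓`hloinv_loPrintAC_of_uniqueMinOrbit` (door 1: r1 + `huniq`), `hcharge` on `O_ε ∩ {wt ≠ 0}` = ✓`hcharge_intWindow_of_floor`
(door 3) + ✓`hcharge_mono_set` through `O_ε ∩ {χB ≠ 0} ∩ intWindowT3 k ⊆ O_ε ∩ {χB·𝟙[loPrintAC k] ≠ 0}` (✓`intWindowT3_subset_loPrintAC`).  COMPARE ✓p777817's ★ (same conclusion
`Fibre57LowOnAC … (loPrintAC …) k`): there the (58)-floor pin `hFl` carried the bare `χB` and the theorem displayed `hdom`; here the pin carries `χB·𝟙[loPrintAC k]` and `hdom` is GONE —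
the price is `hfloor` (the (E1) floor `2·max(B₃,1)·√L < L²`) and `huniq` ([7] Thm 1 sentence 2), both already displayed letters of the cell's census.  This is the (R7a)∕(R7d) lower row
(`logFl⁻` with print's χ_k cut) typed end to end modulo B0's pins; it does NOT resolve the χ-clash of the registered pair (that needs #22's cut or a second slot — the planner's (R7) decision).

HONEST SCOPE.  [folklore] assembly of landed theorems; def-free; the weighted pins, `huniq`, `hfloor`, `ha₁`, `hγs` are HYPOTHESES; nothing of #22∕#23 as registered, of `hdom`, of (47)∕(57), the (α) data
rows (0∕23), (O‴χₛ), `HistoryTailL` (19936), EX, LOWB∘ or `YM3TorusSU2` is proved (rung R3 = SU(2) YM₃ on T³, a RECORD rung: NOT d = 4, NOT infinite volume, NOT a mass gap, NOT Clay; the Yang–Mills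
mass gap is NOT proved).  L-floor: `hfloor` (displayed).
References: T. Bałaban, Commun. Math. Phys. **102** (1985) 255–275 [Balaban1985UV3] ((37) p.265, (47) p.267, (55)–(58) pp.269–270, p.272 L32–33); **102** (1985) 277–309 [Balaban1985Variational]
(Thm 1 (8) p.279); **109** (1987) 249–301 [Balaban1987RG1] ((0.4) p.253).
-/

set_option autoImplicit false

noncomputable section

namespace Summit.QuantumFields.YangMills.Theorems

open MeasureTheory Literature.MathematicalPhysics.QuantumFieldTheory.Balaban1983to89
open Literature.MathematicalPhysics.QuantumFieldTheory.Balaban1983to89.GaugeField (GaugeInvariant gaugeAct)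
open Literature.MathematicalPhysics.QuantumFieldTheory.Balaban1983to89.BlockAveraging (avgFun loopHol Idx)
open Literature.MathematicalPhysics.QuantumFieldTheory.Balaban1983to89.ExpMeanLog (expMeanLogSU)
open Literature.MathematicalPhysics.QuantumFieldTheory.Balaban1983to89.T3ContinuumYM3Torus
open Literature.MathematicalPhysics.QuantumFieldTheory.Balaban1983to89.T3UnitScaleTilt (θBal)
open Literature.MathematicalPhysics.QuantumFieldTheory.Balaban1983to89.T3Thm1Carrier (varProblem3)
open Literature.MathematicalPhysics.QuantumFieldTheory.Balaban1985CMP102 Literature.MathematicalPhysics.QuantumFieldTheory.Balaban1985CMP102.Setting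
open Summit.QuantumFields.Balaban3D.Carriers
open Summit.QuantumFields.Balaban3D.Proofs.Primitives
open Summit.QuantumFields.Balaban3D.Proofs.Thresholds (Q0 Q0_pos)
open Summit.QuantumFields.Balaban3D.Proofs.TowerAC Summit.QuantumFields.Balaban3D.Proofs.StandardAC Summit.QuantumFields.Balaban3D.Proofs.InputsAC
open Summit.QuantumFields.Balaban3D.Proofs.Bound55Masses (chiB)
open Summit.QuantumFields.Balaban3D.Proofs.GaussianNormalization (partZ normalized)
open Summit.QuantumFields.YangMills.Theorems.PinnedStep (Fibre57LowOnAC)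
open scoped NNReal ENNReal

namespace AlphaInputsT3AC.PkgCoreRows

variable {F : T3Family} {𝔠 : AlphaConsts F.L (suGroupModel 2).N} {γ : ℝ} {hγ : 0 < γ} {hγ1 : γ ≤ (min 𝔠.gamma0 1) ^ 2} {K : ℕ}
  (q : AlphaInputsT3AC.PkgCoreRows F 𝔠 γ hγ hγ1 K)

/-- ★★★★ **THE RC-B LOWER ROW AT PRINT'S FAMILY, ASSEMBLED** — `Fibre57LowOnAC 𝔠.lane q.X q.𝔖 (loPrintAC 𝔠.lane q.X) k` from: the F2c charts, the Gaussian datum, `hinv`, the (55)∕(58) pins with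
the WEIGHTED floor integrand `χB_k(triv′)·𝟙[loPrintAC k]` (B0's (R7a∕R7d) lower pin), the size window `hγs`, the [7] data-smallness threshold `ha₁`, the (E1) floor `hfloor`, and [7] Thm 1's
uniqueness clause `huniq` — NO `hdom`, NO `hpos`∕`hcharge`∕`hdeep` letter. [cite: Balaban1985UV3, (37) p.265 + (47) p.267 + (55)–(58) pp.269–270 + p.272 L32–33; Balaban1985Variational, Thm 1 (8) p.279] -/
theorem fibre57LowOnAC_T3_loPrintAC_chiMin_weight_of_floor (hγs : γ ≤ ((((4500 : ℝ) * (F.L : ℝ) ^ 5)⁻¹ / (𝔠.b₀ * Q0 𝔠.p₀)) ^ 2) ^ 2)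
    (ha₁ : ∀ i, θBal F.L γ 𝔠.b₀ 𝔠.p₀ i ≤ q.a₁) (hfloor : 2 * max 𝔠.B₃ 1 * Real.sqrt (F.L : ℝ) < (F.L : ℝ) ^ 2)
    (huniq : ∀ (n : ℕ) (hnK : n < K) (ε₁ ε₀ : ℝ), 0 < ε₁ → ε₁ ≤ q.a₁ → 𝔠.B₃ * ε₁ ≤ ε₀ → ε₀ ≤ q.a₀ →
      ∀ V : GaugeField (F.P n) 0 (Matrix.specialUnitaryGroup (Fin 2) ℂ), PlaqSmall ε₁ V →
        ∀ U : GaugeField (F.P K) 0 (Matrix.specialUnitaryGroup (Fin 2) ℂ),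
          (varProblem3 F n K hnK.le).OnMinimalOrbit (𝔠.B₃ * ε₁) V U → (varProblem3 F n K hnK.le).UniqueCriticalOrbit ε₀ V U)
    (k : ℕ) (hk : k + 1 ≤ K)
    (Φ : GaugeField (F.P K) (k + 1) (Matrix.specialUnitaryGroup (Fin 2) ℂ) × GaugeField (F.P K) k (Matrix.specialUnitaryGroup (Fin 2) ℂ) →
      GaugeField (F.P K) k (Matrix.specialUnitaryGroup (Fin 2) ℂ))
    (J : GaugeField (F.P K) (k + 1) (Matrix.specialUnitaryGroup (Fin 2) ℂ) × GaugeField (F.P K) k (Matrix.specialUnitaryGroup (Fin 2) ℂ) → ℝ≥0)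
    (T : Set (GaugeField (F.P K) (k + 1) (Matrix.specialUnitaryGroup (Fin 2) ℂ) × GaugeField (F.P K) k (Matrix.specialUnitaryGroup (Fin 2) ℂ)))
    (hΦ : Measurable Φ) (hJ : Measurable J) (hT : MeasurableSet T)
    (hmap : ((((fieldMeasure (F.P K) (k + 1) (Matrix.specialUnitaryGroup (Fin 2) ℂ)).prod
        (fieldMeasure (F.P K) k (Matrix.specialUnitaryGroup (Fin 2) ℂ))).restrict T).withDensity (fun z => (J z : ℝ≥0∞))).map Φ =
      (fieldMeasure (F.P K) k (Matrix.specialUnitaryGroup (Fin 2) ℂ)).restrict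
        {U : GaugeField (F.P K) k (Matrix.specialUnitaryGroup (Fin 2) ℂ) |
          ∀ c i, dist1 (loopHol U c i) < ((Fintype.card (Idx (F.P K)) : ℝ))⁻¹ / 10})
    (hfib : ∀ z ∈ T, avgFun (expMeanLogSU (n := Fin 2)) (Φ z) = z.1) (N lσ dg : ℝ)
    (q_1 : GaugeField (F.P K) (k + 1) (Matrix.specialUnitaryGroup (Fin 2) ℂ) → GaugeField (F.P K) k (Matrix.specialUnitaryGroup (Fin 2) ℂ) → ℝ)
    (hqm : ∀ V, Measurable (q_1 V)) (hZ : ∀ V, 0 < partZ (fieldMeasure (F.P K) k (Matrix.specialUnitaryGroup (Fin 2) ℂ)) (q_1 V))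
    (hinv : GaugeInvariant (fun U : GaugeField (F.P K) k (Matrix.specialUnitaryGroup (Fin 2) ℂ) =>
      Real.exp (-((towerOfAC 𝔠.lane q.X q.𝔖).mainT k (Hist.triv (F.P K) k) U) + (towerOfAC 𝔠.lane q.X q.𝔖).Pint k (Hist.triv (F.P K) k) U)))
    (hσ : (piecesAC 𝔠.lane q.X q.𝔖 k).logσ₀ = lσ) (hdg : (piecesAC 𝔠.lane q.X q.𝔖 k).dg = dg)
    (hstar : (piecesAC 𝔠.lane q.X q.𝔖 k).starB (Hist.triv (F.P K) (k + 1)) = N)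
    (hZU : ∀ V, (piecesAC 𝔠.lane q.X q.𝔖 k).logZU (Hist.triv (F.P K) (k + 1)) V =
      Real.log (partZ (fieldMeasure (F.P K) k (Matrix.specialUnitaryGroup (Fin 2) ℂ)) (q_1 V)))
    (hFl : ∀ V, (piecesAC 𝔠.lane q.X q.𝔖 k).logFl (Hist.triv (F.P K) (k + 1)) V =
      Real.log (∫ U', (Real.exp (-((lσ + dg * Real.log ((T3Scales F γ hγ (hγ1.trans (sq_min_one_le _ 𝔠.gamma0_pos)) K).gk k)) * N)) * T.indicator (fun z => (J z : ℝ)) (V, U')) *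
              (chiB 𝔠.lane.carrier.M₁ (rcolOf (T3Scales F γ hγ (hγ1.trans (sq_min_one_le _ 𝔠.gamma0_pos)) K) 𝔠.lane.carrier) (eps1Of (T3Scales F γ hγ (hγ1.trans (sq_min_one_le _ 𝔠.gamma0_pos)) K) 𝔠.lane.carrier) k
                  (Hist.triv (F.P K) (k + 1)) (Φ (V, U')) * (PinnedStep.loPrintAC 𝔠.lane q.X k).indicator (fun _ => (1 : ℝ)) (Φ (V, U'))) *
              Real.exp (-((towerOfAC 𝔠.lane q.X q.𝔖).mainT k (Hist.triv (F.P K) k) (Φ (V, U')) -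
                    (towerOfAC 𝔠.lane q.X q.𝔖).mainT (k + 1) (Hist.triv (F.P K) (k + 1)) V)
                + ((towerOfAC 𝔠.lane q.X q.𝔖).Pint k (Hist.triv (F.P K) k) (Φ (V, U')) - (piecesAC 𝔠.lane q.X q.𝔖 k).Pold (Hist.triv (F.P K) (k + 1)) V)
                + q_1 V U')
            ∂(normalized (fieldMeasure (F.P K) k (Matrix.specialUnitaryGroup (Fin 2) ℂ)) (q_1 V)))) :
    Fibre57LowOnAC 𝔠.lane q.X q.𝔖 (PinnedStep.loPrintAC 𝔠.lane q.X) k  := by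
  have hkK : k ≤ K := by omega
  have hkm : k + 1 ≤ F.m + K := by omega
  have hlom : MeasurableSet (PinnedStep.loPrintAC 𝔠.lane q.X k) := PinnedStep.measurableSet_loPrintAC 𝔠.lane q.X k ((q.runRows.steps k hk).hU _)
  have hlom₁ : MeasurableSet (PinnedStep.loPrintAC 𝔠.lane q.X (k + 1)) := PinnedStep.measurableSet_loPrintAC 𝔠.lane q.X (k + 1) (q.measurable_UkH (k + 1) hk _)
  have hloinv := q.hloinv_loPrintAC_of_uniqueMinOrbit ha₁ huniq k hkK
  obtain ⟨hwtm, hwt0, hwt1, hwtinv, hwtχ, hwtlo⟩ :=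
    PinnedStepTrivPins.chiB_mul_indicator_props 𝔠.lane (S := T3Scales F γ hγ (hγ1.trans (sq_min_one_le _ 𝔠.gamma0_pos)) K) (PinnedStep.loPrintAC 𝔠.lane q.X) k hlom hloinv
  -- the charging letter on `O_ε ∩ {χB·𝟙[loPrintAC k] ≠ 0}` from door 3's interior-window charging (`intWindowT3 k ⊆ loPrintAC k` under `ha₁`)
  have hSS' : {U : GaugeField (F.P K) k (Matrix.specialUnitaryGroup (Fin 2) ℂ) | ∀ c i, dist1 (loopHol U c i) < ((Fintype.card (Idx (F.P K)) : ℝ))⁻¹ / 10} ∩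
        {U | chiB 𝔠.lane.carrier.M₁ (rcolOf (T3Scales F γ hγ (hγ1.trans (sq_min_one_le _ 𝔠.gamma0_pos)) K) 𝔠.lane.carrier)
            (eps1Of (T3Scales F γ hγ (hγ1.trans (sq_min_one_le _ 𝔠.gamma0_pos)) K) 𝔠.lane.carrier) k (Hist.triv (F.P K) (k + 1)) U ≠ 0} ∩
        AlphaInputsT3AC.intWindowT3 F 𝔠 γ K k ⊆
      {U : GaugeField (F.P K) k (Matrix.specialUnitaryGroup (Fin 2) ℂ) | ∀ c i, dist1 (loopHol U c i) < ((Fintype.card (Idx (F.P K)) : ℝ))⁻¹ / 10} ∩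
        {U | chiB 𝔠.lane.carrier.M₁ (rcolOf (T3Scales F γ hγ (hγ1.trans (sq_min_one_le _ 𝔠.gamma0_pos)) K) 𝔠.lane.carrier)
            (eps1Of (T3Scales F γ hγ (hγ1.trans (sq_min_one_le _ 𝔠.gamma0_pos)) K) 𝔠.lane.carrier) k (Hist.triv (F.P K) (k + 1)) U *
          (PinnedStep.loPrintAC 𝔠.lane q.X k).indicator (fun _ => (1 : ℝ)) U ≠ 0} := by
    rintro U ⟨⟨hO, hχ⟩, hI⟩
    refine ⟨hO, mul_ne_zero hχ ?_⟩
    have hmem := q.intWindowT3_subset_loPrintAC ha₁ k hkK hI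
    intro h0
    have h1 : (PinnedStep.loPrintAC 𝔠.lane q.X k).indicator (fun _ => (1 : ℝ)) U = 1 := Set.indicator_of_mem hmem _
    exact one_ne_zero (h1.symm.trans h0)
  have hcharge := PinnedStepTrivPins.hcharge_mono_set F K (PinnedStep.loPrintAC 𝔠.lane q.X) hSS' (q.hcharge_intWindow_of_floor hγs hfloor k hk)
  exact PinnedStepTrivPins.fibre57LowOnAC_T3_of_le_gamma_of_hcharge_weight 𝔠 q.X q.𝔖 hγs (PinnedStep.loPrintAC 𝔠.lane q.X) k hkK
    (PinnedStepTrivPins.avg_XT3_eq_avgFun F γ hγ _ K q.reg q.Uk q.UkH q.hU0 q.hUs hkm)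
    Φ J T hΦ hJ hT hmap hfib N lσ dg q_1 hqm hZ
    ((q.runRows.steps k hk).hU _) ((q.runRows.steps k hk).hPm _) (q.𝔄.cP k) ((q.runRows.steps k hk).hPb _)
    hinv hlom hloinv
    (fun U => chiB 𝔠.lane.carrier.M₁ (rcolOf (T3Scales F γ hγ (hγ1.trans (sq_min_one_le _ 𝔠.gamma0_pos)) K) 𝔠.lane.carrier)
        (eps1Of (T3Scales F γ hγ (hγ1.trans (sq_min_one_le _ 𝔠.gamma0_pos)) K) 𝔠.lane.carrier) k (Hist.triv (F.P K) (k + 1)) U *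
      (PinnedStep.loPrintAC 𝔠.lane q.X k).indicator (fun _ => (1 : ℝ)) U)
    hwtm hwt0 hwt1 hwtinv hwtχ hwtlo hσ hdg hstar hZU hFl hlom₁ hcharge

end AlphaInputsT3AC.PkgCoreRows

end Summit.QuantumFields.YangMills.Theorems

end
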